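import Summits.BirchSwinnertonDyer.BirchSwinnertonDyer.Theorems.ResidualThetaTransportAtTwoResidualSignedLambdaLowerCMAtTwoAwayExhaustion
import Summits.BirchSwinnertonDyer.BirchSwinnertonDyer.Theorems.ResidualThetaTransportAtTwoResidualSignedLambdaLowerCMAtTwoRhoLayerPairingGlueAwayTwo
import HarnessLib

/-!
# GLUE package T2 (b), first half: the KERNEL CRITERION for `jAway w n k : H¹(U_{n,w}, A_ρ[2^k]) → D_w = H¹(ℚ_{∞,w̃}, A_ρ)`
# — group direction (injectivity half of `D_w = lim→_{n,k} H¹(U_{n,w}, A_ρ[2^k])`) — and the CHARACTER GLUE (a compatible directed family of level characters on an exhausted group is ONE character)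

Route `ResidualThetaTransportAtTwo` (RTT), crux RSL_g `ResidualSignedLambdaLowerCMAtTwo` (stmt-BirchSwinnertonDyer-22608), line «onepair»; LEAD
`prover-bsd-wall-rtt-p2` g18 (`--supports 22608 --as helper`, closes nothing). THEOREMS ONLY (no definition, no named fact, no instance,
no `sorry`). BSD is not proved by any of this; RSL_g (22608) stays OPEN.

WHY (GLUE-SPEC-g18 §1 T2 (b); AWAYTWO-FRAME-g18 §1 seam (c)). The S₀-side pin bundle `AwayPins` (file `…AwayDefs`) asks for a Pontryagin-valued
localisation `locdS x w c : CharacterModule (Dloc w)` with prescribed values on the images of `jAway w m k` (`AwayPins.hlocdS`). Its EXISTENCE is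
the direct-limit universal property of `D_w`: surjectivity = EXHAUSTION (`ProfiniteExhaustion.exists_jAway_eq_from`, w2 p700479) and injectivity =
the kernel criterion, whose GROUP direction is §1 (Serre I §2.2 Prop. 8 for the open tower `U_{n,w} ↘ U_{∞,w}`: the locus `{φ = ∂v}` is open and
contains `⋂ₘ U_m`, hence some `U_m` by compactness — the port of the sorry-free crux sketch
`Cruxes/ResidualThetaCountLowerPureAtTwo/Sketch_sidea_k2_g17.lean` §1 (B), credit stub-ideation k2 g17; the coefficient direction — the coboundary
witness `v ∈ A_ρ` is `2`-primary — and the `jAway`-form with the transitions `tAway` follow in the sequel `…AwayKernelTransitions`). §2 is the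
pure-algebra glue (same sketch §3): from (P) compatibility of the level characters along the transitions, (E) exhaustion and (K) the kernel
criterion, the level characters are ONE additive map on the limit, uniquely — the EXISTENCE of `AwayPins.locdS x w c`.

* §1 `AwayKernel.exists_resLe_eq_zero_of_resLe_eq_zero` (generic profinite `G`, open antitone tower `Tₙ`, `H = ⋂ Tₙ`), and its local-tower
  instance `AwayKernel.exists_resLe_layerGroup_eq_zero` (`U_{n,w} ↘ U_{∞,w} = kerGroup κ w`).
* §2 `AwayKernel.addMonoidHom_ext_of_exhaust`, `AwayKernel.apply_eq_of_eq`, **`AwayKernel.exists_addMonoidHom_of_directed`**, `…existsUnique…`.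

References: [SerreGaloisCohomology1997] I §2.2 Prop. 8; [Shatz1972] Ch. II §2; [GreenbergVatsal2000] §2 Prop. 2.4; [Kato2004Asterisque] §13.8.
-/

set_option autoImplicit false
-- the Theorems namespace of this sub repeats the summit name by design (D-0017 nested layout)
set_option linter.dupNamespace false

noncomputable section

open scoped Classical
open CategoryTheory Topology Field NumberField IsDedekindDomain
open Literature.NumberTheory.GaloisRepresentations Literature.NumberTheory.EllipticCurves
open Literature.NumberTheory.EllipticCurves.GreenbergSelmer Literature.NumberTheory.EllipticCurves.CyclotomicLayer

namespace Summit.BirchSwinnertonDyer.BirchSwinnertonDyer.Theorems.ThetaTransport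

universe u

/-! ## §1 The kernel criterion along an open antitone tower of a profinite group (generic), and on the local layer tower -/

namespace AwayKernel

section Generic

variable {G : Type u} [Group G] [TopologicalSpace G] [IsTopologicalGroup G] [CompactSpace G]
  {A : Type u} [AddCommGroup A] [TopologicalSpace A] [DiscreteTopology A]
  (τ : ContinuousRep G ℤ A)
  (T : ℕ → Subgroup G) (hT : Antitone T) (hTo : ∀ n, IsOpen (T n : Set G))
  (H : Subgroup G) (hle : ∀ n, H ≤ T n) (hH : ∀ g : G, (∀ n, g ∈ T n) → g ∈ H)

include hT hTo hH in
/-- **Injectivity half of `H¹(H, A) = lim→ₙ H¹(Tₙ, A)` (kernel criterion).** If `c ∈ H¹(Tₙ, A)` restricts to zero on `H = ⋂ₘ Tₘ`, then already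
`res^{Tₙ}_{Tₘ} c = 0` for some `m ≥ n`: writing `c = [φ]`, `φ|_H = ∂a`, the locus `{φ = ∂a} ⊆ Tₙ` is open and contains `⋂ₘ Tₘ`, hence some `Tₘ`
(compactness). Port of the crux sketch `Sketch_sidea_k2_g17` §1 (B) (credit: stub-ideation k2 g17), itself a port of
`ZpExtension.exists_resLe_layerSubgroup_eq_zero`. [cite: SerreGaloisCohomology1997, I §2.2 Prop. 8] -/
theorem exists_resLe_eq_zero_of_resLe_eq_zero {n : ℕ}
    (c : continuousCohomology 1 (subgroupRep τ.toTopRep (T n))) (hc : resLe τ.toTopRep (hle n) 1 c = 0) :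
    ∃ m, ∃ hm : n ≤ m, resLe τ.toTopRep (hT hm) 1 c = 0 := by
  obtain ⟨φ, rfl⟩ := oneCocycleClass_surjective _ c
  rw [resLe_oneCocycleClass, oneCocycleClass_eq_zero_iff] at hc
  obtain ⟨a, ha⟩ := hc
  have ha' : ∀ (g : G) (hg : g ∈ H), φ.1 ⟨g, hle n hg⟩ = τ g a - a := fun g hg ↦ ha ⟨g, hg⟩
  -- the open locus `{φ = ∂a}` of `Tₙ`
  let Z : Set (T n) := {x | φ.1 x = τ (x : G) a - a}
  have hZ : IsOpen Z := by
    have h1 : Z = (fun x : T n ↦ φ.1 x - (τ (x : G) a - a)) ⁻¹' {0} := by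
      ext x
      simp only [Z, Set.mem_setOf_eq, Set.mem_preimage, Set.mem_singleton_iff, sub_eq_zero]
    rw [h1]
    exact (isOpen_discrete _).preimage (φ.1.continuous.sub
      (((τ.continuous_apply_left a).comp continuous_subtype_val).sub continuous_const))
  have hZ' : IsOpen (Subtype.val '' Z) := (hTo n).isOpenMap_subtype_val Z hZ
  -- compactness: some `Tₘ` lies in the locus
  obtain ⟨m, hm⟩ := exists_subset_nhds_of_compactSpace (V := fun m : ℕ ↦ (T m : Set G))
    (fun i j ↦ ⟨max i j, SetLike.coe_subset_coe.2 (hT (le_max_left i j)),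
      SetLike.coe_subset_coe.2 (hT (le_max_right i j))⟩)
    (fun m ↦ (T m).isClosed_of_isOpen (hTo m)) (U := Subtype.val '' Z) (fun x hx ↦ by
      have hker : x ∈ H := hH x fun k ↦ Set.mem_iInter.1 hx k
      exact hZ'.mem_nhds ⟨⟨x, hle n hker⟩, ha' x hker, rfl⟩)
  refine ⟨max m n, le_max_right m n, ?_⟩
  rw [resLe_oneCocycleClass, oneCocycleClass_eq_zero_iff]
  refine ⟨a, fun g ↦ ?_⟩
  obtain ⟨x, hxZ, hxg⟩ := hm (hT (le_max_left m n) g.2)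
  have hx : x = ⟨(g : G), hT (le_max_right m n) g.2⟩ := Subtype.ext hxg
  subst hx
  exact hxZ

end Generic

section LocalTower

variable {p : ℕ} [Fact p.Prime] (κ : ZpExtension ℚ p) (v : HeightOneSpectrum (𝓞 ℚ))
  {M : Type} [AddCommGroup M] [TopologicalSpace M] [DiscreteTopology M] (ρM : DiscreteGaloisModule ℚ M)

/-- **Kernel criterion for the local layer tower** `U_{n,v} = layerGroup κ v n ↘ U_{∞,v} = kerGroup κ v` (injectivity half of
`H¹(ℚ_{∞,ṽ}, M) = lim→ₙ H¹(U_{n,v}, M)`): a class of `H¹(U_n, M|)` dying on `U_∞` dies on some `U_m`, `m ≥ n`.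
[cite: SerreGaloisCohomology1997, I §2.2 Prop. 8] [cite: GreenbergVatsal2000, §2 Prop. 2.4] -/
theorem exists_resLe_layerGroup_eq_zero {n : ℕ} (c : continuousCohomology 1 (subgroupRep (localRepOf ρM v) (layerGroup κ v n)))
    (hc : resLe (localRepOf ρM v) (kerGroup_le_layerGroup κ v n) 1 c = 0) :
    ∃ m, ∃ hm : n ≤ m, resLe (localRepOf ρM v) (ProfiniteExhaustion.antitone_layerGroup κ v hm) 1 c = 0 := by
  haveI : CompactSpace (absoluteGaloisGroup (v.adicCompletion ℚ)) := absoluteGaloisGroup_compactSpace (v.adicCompletion ℚ)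
  exact exists_resLe_eq_zero_of_resLe_eq_zero (GaloisRep.restrictField (v.adicCompletion ℚ) ρM) (layerGroup κ v)
    (ProfiniteExhaustion.antitone_layerGroup κ v) (isOpen_layerGroup κ v) (kerGroup κ v) (kerGroup_le_layerGroup κ v)
    (fun g hg ↦ by
      rw [ProfiniteExhaustion.kerGroup_eq_iInf_layerGroup]
      exact Subgroup.mem_iInf.2 hg) c hc

end LocalTower

end AwayKernel

end Summit.BirchSwinnertonDyer.BirchSwinnertonDyer.Theorems.ThetaTransport

/-! ## §2 The character glue: a compatible directed family of level characters on an exhausted group is ONE character -/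

namespace Summit.BirchSwinnertonDyer.BirchSwinnertonDyer.Theorems.ThetaTransport.AwayKernel

section Glue

variable {ι : Type*} [Preorder ι] [IsDirected ι (· ≤ ·)] {D : ι → Type*} [∀ i, AddCommGroup (D i)]
  {L T : Type*} [AddCommGroup L] [AddCommGroup T]
  (t : ∀ i i', i ≤ i' → D i →+ D i') (j : ∀ i, D i →+ L) (χ : ∀ i, D i →+ T)
  (hjt : ∀ i i' (h : i ≤ i') (x : D i), j i' (t i i' h x) = j i x)
  (hχt : ∀ i i' (h : i ≤ i') (x : D i), χ i' (t i i' h x) = χ i x)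
  (hex : ∀ y : L, ∃ i, ∃ x : D i, j i x = y)
  (hker : ∀ i (x : D i), j i x = 0 → ∃ i', ∃ h : i ≤ i', t i i' h x = 0)

include hex in
omit [Preorder ι] [IsDirected ι (· ≤ ·)] in
/-- **Uniqueness**: two additive maps on `L` agreeing on every level image are equal (`L` exhausted by the `j i`). Port of the crux sketch
`Sketch_sidea_k2_g17` §3 (credit: stub-ideation k2 g17). [cite: SerreGaloisCohomology1997, I §2.2] -/
theorem addMonoidHom_ext_of_exhaust {Χ Χ' : L →+ T}
    (h : ∀ i (x : D i), Χ (j i x) = Χ' (j i x)) : Χ = Χ' := by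
  ext y
  obtain ⟨i, x, rfl⟩ := hex y
  exact h i x

include hjt hχt hker in
/-- Compatibility of the level characters on equal images, from (P) `hχt` + (K) the kernel criterion `hker`.
[cite: SerreGaloisCohomology1997, I §2.2 Prop. 8] -/
theorem apply_eq_of_eq {i i' : ι} (x : D i) (x' : D i') (he : j i x = j i' x') : χ i x = χ i' x' := by
  obtain ⟨i₀, hi, hi'⟩ := exists_ge_ge i i'
  have h0 : j i₀ (t i i₀ hi x - t i' i₀ hi' x') = 0 := by rw [map_sub, hjt, hjt, he, sub_self]
  obtain ⟨i₁, h₁, hz⟩ := hker i₀ _ h0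
  have h2 : χ i₁ (t i₀ i₁ h₁ (t i i₀ hi x - t i' i₀ hi' x')) = 0 := by rw [hz, map_zero]
  rw [hχt, map_sub, hχt, hχt, sub_eq_zero] at h2
  exact h2

include hjt hχt hex hker in
/-- **Existence**: the level characters glue to ONE additive map `Χ : L →+ T` with `Χ ∘ j i = χ i` — given (P) compatibility along the
transitions, (E) exhaustion and (K) the kernel criterion (`L` is then the direct limit of the `D i` and `Χ` its universal arrow). Port of the crux
sketch `Sketch_sidea_k2_g17` §3 (credit: stub-ideation k2 g17). [cite: SerreGaloisCohomology1997, I §2.2 Prop. 8] -/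
theorem exists_addMonoidHom_of_directed : ∃ Χ : L →+ T, ∀ i (x : D i), Χ (j i x) = χ i x := by
  choose idx pre hpre using hex
  have hc := fun {i i' : ι} (x : D i) (x' : D i') (he : j i x = j i' x') ↦ apply_eq_of_eq t j χ hjt hχt hker x x' he
  refine ⟨AddMonoidHom.mk' (fun y ↦ χ (idx y) (pre y)) fun y₁ y₂ ↦ ?_, fun i x ↦ hc _ _ (hpre _)⟩
  obtain ⟨i₀, h₁, h₂⟩ := exists_ge_ge (idx y₁) (idx y₂)
  have hsum : j i₀ (t _ i₀ h₁ (pre y₁) + t _ i₀ h₂ (pre y₂)) = y₁ + y₂ := by rw [map_add, hjt, hjt, hpre, hpre]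
  change χ (idx (y₁ + y₂)) (pre (y₁ + y₂)) = χ (idx y₁) (pre y₁) + χ (idx y₂) (pre y₂)
  rw [hc (pre (y₁ + y₂)) (t _ i₀ h₁ (pre y₁) + t _ i₀ h₂ (pre y₂)) (by rw [hpre, hsum]), map_add, hχt, hχt]

include hjt hχt hex hker in
/-- Existence and uniqueness together. [cite: SerreGaloisCohomology1997, I §2.2 Prop. 8] -/
theorem existsUnique_addMonoidHom_of_directed : ∃! Χ : L →+ T, ∀ i (x : D i), Χ (j i x) = χ i x := by
  obtain ⟨Χ, hΧ⟩ := exists_addMonoidHom_of_directed t j χ hjt hχt hex hker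
  exact ⟨Χ, hΧ, fun Χ' hΧ' ↦ addMonoidHom_ext_of_exhaust j hex fun i x ↦ (hΧ' i x).trans (hΧ i x).symm⟩

end Glue

end Summit.BirchSwinnertonDyer.BirchSwinnertonDyer.Theorems.ThetaTransport.AwayKernel

end
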